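import Literature.MathematicalPhysics.QuantumFieldTheory.Balaban1983to89.B7Eq162GeneralRec
import Literature.MathematicalPhysics.QuantumFieldTheory.Balaban1983to89.B7Eq99ConcreteRec
import Literature.MathematicalPhysics.QuantumFieldTheory.Balaban1983to89.B7Eq84ConcreteRec
import Literature.MathematicalPhysics.QuantumFieldTheory.Balaban1983to89.B8Prop7AdmittedFamily

/-!
# `Balaban1983to89.B8Prop7AdmittedFamilyRec` — RECORD TWIN of `B8Prop7AdmittedFamily` §1 (the UNITARITY CHAIN: the record's double-bar averages `U̿₁ʲ` (90)∕(91), block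
# frames (82), frames `v_j` (97)∕(160) and the gauge fixing `u` of [Balaban1985Averaging] ((77) + (87), `glevZ`) are UNITARY-VALUED in the small-field regime) FOR THE
# SYMMETRISED CENTRED block averaging (0.4) of [Balaban1987RG1], with the RECORD's Prop-4 regime

statement-level skeleton of published theorems with citation tags; proofs where landed; nothing here is a claim about the Yang–Mills mass gap

T. Bałaban, *Averaging operations for lattice gauge theories*, Commun. Math. Phys. **98** (1985) 17–51 `[Balaban1985Averaging]` ("[3]"): (22)–(24) p. 21, (52)–(53) p. 26,
(58)–(59) p. 27, (65)–(69) p. 29, (76)–(77) pp. 29–30, (82) p. 30, (87)–(93) pp. 31–32, (97) p. 32, (159)–(162) p. 42; T. Bałaban, *Spaces of regular gauge field configurations on a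
lattice and gauge fixing conditions*, Commun. Math. Phys. **99** (1985) 75–102 `[Balaban1985RegularSpaces]` ("[6]"): p. 81, (1.139)–(1.141) p. 100; T. Bałaban, *Renormalization
group approach to lattice gauge field theories. I*, Commun. Math. Phys. **109** (1987) 249–301 `[Balaban1987RG1]` ("[I]"): (0.3)–(0.4) pp. 252–253.  STATUS: published.

CITATION HEADER (lean-in-tree rule).  Cell `pub-ymgap`, «N05-REC» stage 2 (director-ym №254∕№255∕№288), item R5-γ (Sect. E ∕ Prop 5 join for the record, dag-n05-c's remainder list,
HANDOFF g26) — typed by the LEAD PEN dag-n05-e g38 (inventory `N05-REC-INVENTORY.md` §R5 row `B8Prop7AdmittedFamily`: class A = `glev_mem_unitaryUnits dbavgCovIter_vcov_mem_unitaryUnits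
avgIter_mem_unitaryUnits avgIter_mul_mem_unitaryUnits twist_le_quarter tild_eq_of_mgauge`, class C = `wframe_mem_unitaryUnits`).  WHAT IS REPRODUCED = ✓ these seven declarations under
the token map, over `B7Prop2Rec.avgIterZ_mem`, `B7Eq162GeneralRec.norm_twistZ_general` (record constant `2dKZ·L^{j+1}b`, smallness `1024·d·KZ·Lᵏb ≤ 1`), `B7Eq92ConcreteRec.{tildZ_mgauge,
tildIterZ_eq_mgauge, tildIterZ_mul, dbavgCovIterZ_succ_apply, dbavgCovZ_apply, vcovZ_succ_apply}`, `B7Eq84ConcreteRec.{glevZ_top, glevZ_of_lt}`, `B7Eq99ConcreteRec.wrecZ_eq_vcovZ`; the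
token-free `tHol_mem_unitaryUnits`, `Rc_mem_unitaryUnits` BY NAME.  TOKEN MAP: `avgIter ∕ tild ∕ tildIter ∕ wframe ∕ Fcov ∕ dbavgCovIter ∕ vcov ∕ glev ∕ wrec ∕ bavg ↦ …Z`; block offsets
`boxVec L r ↦ offZ L r`; regime `(hL : 2 ≤ L) ↦ (hLs : L = 2s+1) (hs : 1 ≤ s) (hd : 1 ≤ d)`, `C0 ↦ C0Z`, the engine window `e^{4·800…α₀}(1 + 8C₁Lᵏb) ≤ 2`, `2Lᵏb ≤ c₃`, `2048dLᵏb ≤ 1`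
↦ the record's `e^{4cZ·α₀}(1 + 2C₁KZ²·Lᵏb) ≤ 2`, `KZ·Lᵏb ≤ c₃`, `1024·d·KZ·Lᵏb ≤ 1`.  The engine's §2–§4 (Prop. 7 proper) are not on the crown's kernel cone and are not twinned.
Declaration names = engine names with the object token `Z` (T5).  Kind «kernel-checked proof», theorems only; no `def`, no `instance`, no `notation`, no existing module modified.
`--supports stmt-QuantumFields-20541` (K0⁷-keyed, COUNT-NEUTRAL).

HONEST SCOPE: group algebra + the unitarity of exponentials of skew-adjoint elements; nothing of Bałaban's analysis re-proved; `HThm4Rec` UNDISCHARGED; caveat (C-S3-1) + addendum v4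
stand; N05 [B8] DISCHARGED OF RECORD untouched; N05 ∕ N07 NOT discharged; COUNT of record unmoved · K numerically unchanged; one finite `𝕋⁴` programme at fixed `ε`, Bałaban AS PRINTED;
nothing continuum ∕ ℝ⁴ ∕ OS ∕ mass-gap ∕ Clay.  No `sorry`, no `def`.

[cite: Balaban1985Averaging, (22)–(24) p.21, (52)–(53) p.26, (82) p.30, (87)–(93) pp.31–32, (97) p.32, (159)–(162) p.42; Balaban1985RegularSpaces, p.81, (1.139)–(1.141) p.100; Balaban1987RG1, (0.3)–(0.4) pp.252–253]
-/

noncomputable section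

open NormedSpace

namespace Literature.MathematicalPhysics.QuantumFieldTheory.Balaban1983to89.B8Prop7AdmittedFamilyRec

open B7Prop1Explicit B7Prop2Explicit B7Prop3Flat MatrixLog
open B7Eq92Concrete (mgauge mgauge_apply mgauge_mul Rc Rc_apply tHol)
open B7Prop2Rec (AvgClosedZ C0Z avgClosedZ_unitaryUnits avgIterZ_mem)
open B7Prop4GeneralLevelsRec (cZ gZ KZ gZ_nonneg)
open BlockAveragingZd (avgIterZ bavgZ offZ l1_offZ_le)
open B7SectCDGaugeAveragesRec (tildZ tildIterZ FcovZ wframeZ dbavgCovZ dbavgCovIterZ vcovZ glevZ wrecZ)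
open B7Eq92ConcreteRec (tildZ_apply tildZ_mgauge tildIterZ_eq_mgauge tildIterZ_mul dbavgCovIterZ_succ_apply dbavgCovZ_apply vcovZ_succ_apply)
open B7Eq84ConcreteRec (glevZ_top glevZ_of_lt)
open B7Eq99ConcreteRec (wrecZ_eq_vcovZ)
open B7Eq162GeneralRec (norm_twistZ_general)
open B7Prop8PrintedConstants (Rc_mem_unitaryUnits)
open B8Prop7AdmittedFamily (tHol_mem_unitaryUnits)

-- `Site` alone would resolve to the torus sites of `Setup.lean`; re-export the `ℤ^d` sites of `B7Prop1Explicit`.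
export B7Prop1Explicit (Site)

variable {d : ℕ}

/-! ## §1 The unitarity chain for the RECORD averages -/

section Unitarity

variable {𝔸 : Type*} [CStarAlgebra 𝔸]

/-- (RECORD TWIN of `B8Prop7AdmittedFamily.wframe_mem_unitaryUnits`.) **The record block frame (82) `\overline{R_{0,y}W} = exp[Σ_{x∈B(y)} L^{−d} log (R_{0,y}W)(Γ_{y,x})]`
(centred block, offsets `offZ`) is unitary** when `V₀`, `W` are unitary-valued and every twisted transport along the block contours is within `1/4` of `1` ((22)–(23): the
logarithms are skew-adjoint, Mathlib `NormedSpace.exp_mem_unitary_of_mem_skewAdjoint`). [cite: Balaban1985Averaging, (82) p.30, (22)–(23) p.21; Balaban1987RG1, (0.3) p.252] -/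
theorem wframeZ_mem_unitaryUnits (L : ℕ) {V₀ W : Site d → Fin d → 𝔸ˣ} (hV₀ : ∀ x κ, V₀ x κ ∈ unitaryUnits 𝔸)
    (hW : ∀ x κ, W x κ ∈ unitaryUnits 𝔸) (y : Site d)
    (hsmall : ∀ r : Fin d → Fin L, ‖((tHol V₀ W y (treeWord (offZ L r)) : 𝔸ˣ) : 𝔸) - 1‖ ≤ 1 / 4) :
    wframeZ L V₀ W y ∈ unitaryUnits 𝔸 := by
  have hF : FcovZ L V₀ W y ∈ skewAdjoint 𝔸 := by
    unfold FcovZ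
    refine sum_mem fun r _ => skewAdjoint.smul_mem _ ?_
    rw [skewAdjoint.mem_iff]
    exact star_mlog_eq_neg ((mem_unitaryUnits).1 (tHol_mem_unitaryUnits hV₀ hW y _)) (hsmall r)
  letI : NormedAlgebra ℚ 𝔸 := NormedAlgebra.restrictScalars ℚ ℂ 𝔸
  rw [mem_unitaryUnits, wframeZ, val_expUnit]
  exact NormedSpace.exp_mem_unitary_of_mem_skewAdjoint hF

/-- (RECORD TWIN of `B8Prop7AdmittedFamily.tild_eq_of_mgauge`.) **(89) through (92)∕(93), pure group algebra, record one-step average**: for ANY frame function `v`,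
`W̃(c) = v(c₋)⁻¹·\widetilde{W^{v}}(c)·R̄_{0,c}v(c₊)` (`B7Eq92ConcreteRec.tildZ_mgauge` solved for `W̃`). [cite: Balaban1985Averaging, (93) p.32, (59) p.27; Balaban1987RG1, (0.4) p.253] -/
theorem tildZ_eq_of_mgauge (L : ℕ) (V₀ W : Site d → Fin d → 𝔸ˣ) (v : Site d → 𝔸ˣ) (q : Site d) (κ : Fin d) :
    tildZ L V₀ W q κ
      = (v q)⁻¹ * tildZ L V₀ (mgauge V₀ v W) q κ * Rc (bavgZ L V₀ q κ) (v (q + (L : ℤ) • e κ)) := by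
  rw [tildZ_mgauge]
  group

variable [Nontrivial 𝔸]

section Tower

variable {L s k : ℕ} {U₀ : Site d → Fin d → 𝔸ˣ} {B : Site d → Fin d → 𝔸} {α₀ αP b : ℝ}
  (hLs : L = 2 * s + 1) (hs : 1 ≤ s) (hd : 1 ≤ d) (hU₀ : ∀ x κ, U₀ x κ ∈ unitaryUnits 𝔸) (hBu : ∀ x κ, expCfg B x κ ∈ unitaryUnits 𝔸)
  (hα : 0 < α₀) (hα3 : C0Z d * α₀ ≤ 1 / 3) (hα4 : 4 * α₀ ≤ c2' d L) (h52 : pdev U₀ < α₀ * (((L : ℝ) ^ k)⁻¹) ^ 2)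
  (hb : 0 ≤ b) (hB : ∀ x κ, ‖B x κ‖ ≤ b)
  (hsmall : Real.exp (4 * cZ d * α₀) * (1 + 2 * (131072 * ((d : ℝ) + 1) ^ 2) * (KZ d L) ^ 2 * ((L : ℝ) ^ k * b)) ≤ 2)
  (hc₃ : KZ d L * ((L : ℝ) ^ k * b) ≤ c3 d L) (hsm : 1024 * (d : ℝ) * KZ d L * ((L : ℝ) ^ k * b) ≤ 1)
  (hαP : 0 < αP) (hαP3 : C0Z d * αP ≤ 1 / 3) (hαP2 : 2 * αP ≤ c2' d L)
  (hP : pdev (expCfg B * U₀) < αP * (((L : ℝ) ^ k)⁻¹) ^ 2)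

include hLs hs hU₀ hα hα3 hα4 h52 in
/-- (RECORD TWIN of `B8Prop7AdmittedFamily.avgIter_mem_unitaryUnits`.) *"we can apply Proposition 1 to the configuration Ūʲ"* ([3] p. 26) — all record-averaged backgrounds `Ū₀ʲ`,
`j ≤ k`, are unitary-valued (`B7Prop2Rec.avgIterZ_mem` for `G = U(𝔸)`, under (52) `|U₀(∂p) − 1| < α₀L^{−2k}` and the record's Prop.-2 window).
[cite: Balaban1985Averaging, (52)–(53) p.26; Balaban1985RegularSpaces, (1.139) p.100; Balaban1987RG1, (0.4) p.253] -/
theorem avgIterZ_mem_unitaryUnits : ∀ j ≤ k, ∀ (x : Site d) (κ : Fin d), avgIterZ L U₀ j x κ ∈ unitaryUnits 𝔸 :=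
  avgIterZ_mem L (by omega) (avgClosedZ_unitaryUnits d L) k U₀ hU₀ hα hα3 (by linarith) h52

include hLs hs hU₀ hBu hαP hαP3 hαP2 hP in
/-- (RECORD TWIN of `B8Prop7AdmittedFamily.avgIter_mul_mem_unitaryUnits`.) The same for the product configuration `U₁U₀`, `U₁ = e^{B}` unitary-valued, under its own (52)-window
(in Prop. 7: (1.141) «|(U₁U₀)(∂p) − 1| < (α₀ + 3α₂)L^{−2j}»): every record average `\overline{U₁U₀}ʲ`, `j ≤ k`, is unitary-valued.
[cite: Balaban1985Averaging, (52)–(53) p.26; Balaban1985RegularSpaces, (1.141) p.100; Balaban1987RG1, (0.4) p.253] -/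
theorem avgIterZ_mul_mem_unitaryUnits :
    ∀ j ≤ k, ∀ (x : Site d) (κ : Fin d), avgIterZ L (expCfg B * U₀) j x κ ∈ unitaryUnits 𝔸 :=
  avgIterZ_mem L (by omega) (avgClosedZ_unitaryUnits d L) k (expCfg B * U₀)
    (fun x κ => by rw [Pi.mul_apply]; exact (unitaryUnits 𝔸).mul_mem (hBu x κ) (hU₀ x κ)) hαP hαP3 hαP2 hP

include hLs hs hd hU₀ hα hα3 hα4 h52 hb hB hsmall hc₃ hsm in
/-- (RECORD TWIN of `B8Prop7AdmittedFamily.twist_le_quarter`.) The record's twisted transports `(R̄ʲ_{0,y}U̿₁ʲ)(Γ_{y,x})` along the CENTRED block contours (`offZ L r`,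
`|Γ| ≤ d·s ≤ dL`) are within `1/4` of `1` at every level `j < k` (`B7Eq162GeneralRec.norm_twistZ_general`: `≤ 2dKZ·L^{j+1}b ≤ 2dKZ·Lᵏb ≤ 1/512`).
[cite: Balaban1985Averaging, (159)–(162) p.42; Balaban1987RG1, (0.3)–(0.4) pp.252–253] -/
theorem twistZ_le_quarter {j : ℕ} (hj : j < k) (y : Site d) (r : Fin d → Fin L) :
    ‖((tHol (avgIterZ L U₀ j) (dbavgCovIterZ L U₀ (expCfg B) j) y (treeWord (offZ L r)) : 𝔸ˣ) : 𝔸) - 1‖ ≤ 1 / 4 := by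
  have hL1 : (1 : ℝ) ≤ L := by exact_mod_cast (show 1 ≤ L by omega)
  have hv : l1 (offZ L r) ≤ d * L := (l1_offZ_le hLs r).trans (Nat.mul_le_mul_left d (by omega))
  have h := norm_twistZ_general hLs hs hd (avgClosedZ_unitaryUnits d L) hU₀ hα hα3 hα4 h52 hb hB hsmall hc₃ hsm hj y hv
  have hK : 0 ≤ KZ d L := by unfold KZ; have := gZ_nonneg d L; positivity
  have hmono : (L : ℝ) ^ (j + 1) * b ≤ (L : ℝ) ^ k * b := mul_le_mul_of_nonneg_right (pow_le_pow_right₀ hL1 hj) hb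
  have hdK : 0 ≤ 2 * (d : ℝ) * KZ d L := by positivity
  have h2 := mul_le_mul_of_nonneg_left hmono hdK
  have e1 : 2 * (d : ℝ) * KZ d L * ((L : ℝ) ^ k * b) = (1024 * (d : ℝ) * KZ d L * ((L : ℝ) ^ k * b)) / 512 := by ring
  linarith [h, h2, e1, hsm]

include hLs hs hd hU₀ hBu hα hα3 hα4 h52 hb hB hsmall hc₃ hsm hαP hαP3 hαP2 hP in
/-- (RECORD TWIN of `B8Prop7AdmittedFamily.dbavgCovIter_vcov_mem_unitaryUnits`.) **The record's `U̿₁ʲ` (90)∕(91) and frames `v_j` (97)∕(160) are unitary-valued, `j ≤ k`** — by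
induction on `j`: the block frame (82) of `U̿₁ʲ` at `Ū₀ʲ` is unitary (`wframeZ_mem_unitaryUnits`, `twistZ_le_quarter`), hence `v_{j+1} = v_j·\overline{R̄ʲ_{0,·}U̿₁ʲ}` is; and by (89)
with (93) (`tildZ_eq_of_mgauge` at the frame `v_j`, `Ũ₁ʲ = (U̿₁ʲ)^{v_j}` (92)∕(97) `B7Eq92ConcreteRec.tildIterZ_eq_mgauge`) the double-bar average `U̿₁^{j+1}(c)` is a product of unitaries
(the plain record averages (43) by `avgIterZ_mem`). [cite: Balaban1985Averaging, (89)–(92) p.31, (97) p.32, (82) p.30; Balaban1987RG1, (0.4) p.253] -/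
theorem dbavgCovIterZ_vcovZ_mem_unitaryUnits :
    ∀ j ≤ k, (∀ (z : Site d) (κ : Fin d), dbavgCovIterZ L U₀ (expCfg B) j z κ ∈ unitaryUnits 𝔸) ∧
      ∀ z : Site d, vcovZ L U₀ (expCfg B) j z ∈ unitaryUnits 𝔸 := by
  intro j
  induction j with
  | zero =>
    intro _
    exact ⟨fun z κ => by rw [B7SectCDGaugeAveragesRec.dbavgCovIterZ_zero]; exact hBu z κ,
      fun z => by rw [B7Eq92ConcreteRec.vcov_zero]; exact (unitaryUnits 𝔸).one_mem⟩
  | succ j ih =>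
    intro hj1
    have hjk : j < k := Nat.lt_of_succ_le hj1
    obtain ⟨hW, hv⟩ := ih hjk.le
    have hV₀ := avgIterZ_mem_unitaryUnits hLs hs hU₀ hα hα3 hα4 h52 j hjk.le
    have hfr : ∀ y : Site d,
        wframeZ L (avgIterZ L U₀ j) (dbavgCovIterZ L U₀ (expCfg B) j) y ∈ unitaryUnits 𝔸 := fun y =>
      wframeZ_mem_unitaryUnits L hV₀ hW y
        (fun r => twistZ_le_quarter hLs hs hd hU₀ hα hα3 hα4 h52 hb hB hsmall hc₃ hsm hjk y r)
    refine ⟨fun z κ => ?_, fun z => ?_⟩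
    · -- `U̿₁^{j+1}(c)`, `c = ⟨Lz, Lz + Le_κ⟩` read on the `(j+1)`-st lattice
      have h1 : avgIterZ L (expCfg B * U₀) (j + 1) z κ ∈ unitaryUnits 𝔸 :=
        avgIterZ_mul_mem_unitaryUnits hLs hs hU₀ hBu hαP hαP3 hαP2 hP (j + 1) hj1 z κ
      have h2 : avgIterZ L U₀ (j + 1) z κ ∈ unitaryUnits 𝔸 :=
        avgIterZ_mem_unitaryUnits hLs hs hU₀ hα hα3 hα4 h52 (j + 1) hj1 z κ
      have htild : tildZ L (avgIterZ L U₀ j) (tildIterZ L U₀ (expCfg B) j) ((L : ℤ) • z) κ ∈ unitaryUnits 𝔸 := by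
        rw [tildZ_apply, tildIterZ_mul]
        exact (unitaryUnits 𝔸).mul_mem h1 ((unitaryUnits 𝔸).inv_mem h2)
      have hbavg : bavgZ L (avgIterZ L U₀ j) ((L : ℤ) • z) κ ∈ unitaryUnits 𝔸 := h2
      rw [dbavgCovIterZ_succ_apply, dbavgCovZ_apply,
        tildZ_eq_of_mgauge L (avgIterZ L U₀ j) (dbavgCovIterZ L U₀ (expCfg B) j) (vcovZ L U₀ (expCfg B) j),
        ← tildIterZ_eq_mgauge L U₀ (expCfg B) j]
      refine (unitaryUnits 𝔸).mul_mem ((unitaryUnits 𝔸).mul_mem ((unitaryUnits 𝔸).inv_mem (hfr _)) ?_)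
        (Rc_mem_unitaryUnits hbavg (hfr _))
      exact (unitaryUnits 𝔸).mul_mem ((unitaryUnits 𝔸).mul_mem ((unitaryUnits 𝔸).inv_mem (hv _)) htild)
        (Rc_mem_unitaryUnits hbavg (hv _))
    · rw [vcovZ_succ_apply]
      exact (unitaryUnits 𝔸).mul_mem (hv _) (hfr _)

include hLs hs hd hU₀ hBu hα hα3 hα4 h52 hb hB hsmall hc₃ hsm hαP hαP3 hαP2 hP in
/-- (RECORD TWIN of `B8Prop7AdmittedFamily.glev_mem_unitaryUnits`.) **The record's gauge fixing `u` of [3] is unitary-valued at every level**: `u_j = glevZ … k j` ((87)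
`u_k = (\overline{R_{0,·}U₁^{(k)}})⁻¹ = v_k⁻¹` at the top, (76) below along the CENTRED block contours), all factors unitary (`dbavgCovIterZ_vcovZ_mem_unitaryUnits`,
`B7Eq99ConcreteRec.wrecZ_eq_vcovZ`; `(R̄ʲ_{0,y}Ũ₁ʲ)(Γ) = \overline{U₁U₀}ʲ(Γ)·Ū₀ʲ(Γ)⁻¹` by (69)).  B8 p. 81: *"In [3] we have determined the gauge transformation u in terms of the
configuration U₁"*. [cite: Balaban1985Averaging, (76)–(77) pp.29–30, (87) p.31; Balaban1985RegularSpaces, p.81; Balaban1987RG1, (0.3)–(0.4) pp.252–253] -/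
theorem glevZ_mem_unitaryUnits (hL1 : 1 ≤ L) :
    ∀ j ≤ k, ∀ x : Site d, glevZ L hL1 U₀ (expCfg B) k j x ∈ unitaryUnits 𝔸 := by
  -- downward induction on the depth `m = k − j`
  suffices h : ∀ m j : ℕ, j + m = k → ∀ x : Site d, glevZ L hL1 U₀ (expCfg B) k j x ∈ unitaryUnits 𝔸 by
    intro j hj x
    exact h (k - j) j (by omega) x
  intro m
  induction m with
  | zero =>
    intro j hjk x
    have hj : j = k := by omega
    rw [hj, glevZ_top, wrecZ_eq_vcovZ]
    exact (unitaryUnits 𝔸).inv_mem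
      ((dbavgCovIterZ_vcovZ_mem_unitaryUnits hLs hs hd hU₀ hBu hα hα3 hα4 h52 hb hB hsmall hc₃ hsm hαP hαP3 hαP2 hP
        k le_rfl).2 x)
  | succ m ih =>
    intro j hjm x
    have hjk : j < k := by omega
    have hV₀ := avgIterZ_mem_unitaryUnits hLs hs hU₀ hα hα3 hα4 h52 j hjk.le
    have hV₁ := avgIterZ_mul_mem_unitaryUnits hLs hs hU₀ hBu hαP hαP3 hαP2 hP j hjk.le
    rw [glevZ_of_lt L hL1 U₀ (expCfg B) hjk]
    refine Rc_mem_unitaryUnits ((unitaryUnits 𝔸).inv_mem (hol_mem_of hV₀ _ _))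
      ((unitaryUnits 𝔸).mul_mem (ih (j + 1) (by omega) _) ?_)
    -- `(R̄ʲ_{0,y}Ũ₁ʲ)(Γ) = \overline{U₁U₀}ʲ(Γ)·Ū₀ʲ(Γ)⁻¹`
    unfold tHol
    rw [tildIterZ_mul]
    exact (unitaryUnits 𝔸).mul_mem (hol_mem_of hV₁ _ _) ((unitaryUnits 𝔸).inv_mem (hol_mem_of hV₀ _ _))

end Tower

end Unitarity

end Literature.MathematicalPhysics.QuantumFieldTheory.Balaban1983to89.B8Prop7AdmittedFamilyRec

end
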